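import Mathlib
import Literature.NumberTheory.LFunctions.VinogradovKorobovFromRichert
import Summits.ValiantsHypothesis.ValiantsHypothesis.Theorems.LiouvilleSarnakAlignedTypeICharactersMod2nBilinearSieveZeroFreeFinal
import Summits.ValiantsHypothesis.ValiantsHypothesis.Theorems.LiouvilleSarnakAlignedTypeICharactersMod2nBilinearSieveLargeConductor
import HarnessLib

/-!
# Route LiouvilleSarnak — support `AlignedTypeI` (stmt-ValiantsHypothesis-21040), line `characters_mod_2n`:
# the Postnikov–Gallagher zero-free region `HZ` from polynomial growth of `L(s, χ mod 2^j)` near `σ = 1`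
# (Landau–Titchmarsh deduction in the depth aspect)

The leaf's standing conditional closure is `alignedTypeI_of_twoPowerZFR : HZ → AlignedTypeI`
(`…BilinearSieveZeroFreeFinal.lean`), `HZ` = "for every `A`, eventually in `j`, the primitive `χ (mod 2^j)` have no
zeros `β + iγ` with `|γ| ≤ j³` and `β > 1 − A log j/j`".  This file proves `HZ` from a GROWTH hypothesis of Richert /
Vinogradov type in the depth (`q = 2^j`) aspect,

  `HG(C) := ∀ K > 0 ∃ j₀ ∀ j ≥ j₀ ∀ χ ≠ χ₀ (mod 2^j) ∀ z, 1 − K log²j/j ≤ Re z ≤ 2, |Im z| ≤ 2j³ + 1 ⟹ ‖L(z, χ)‖ ≤ j^C`,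

by Titchmarsh's Lemma α / Theorem 3.10 argument run in the `q`-aspect, exactly as the tree's
`Literature.NumberTheory.LFunctions.VKFromRichert.one_sub_re_ge_L` runs it in the `t`-aspect: with `ℓ = log j`,
`d = 8Aℓ/j`, discs of radius `2R`, `R = Kℓ²/(2j)`, about `1 + d + iγ` and `1 + d + 2iγ`, the `3-4-1` inequality
(`DirichletZFR.three_four_one`) gives `4/(d + η) ≤ 3/d + 3K₀ + 5E`, `E = 8(log(2j^C/d) + 1)/R ≪ (C + 3) j/(Kℓ)`,
which is impossible for `η = 1 − β < d/8 = Aℓ/j` once `K = 2304 A (C + 3)` (`VKFromRichert.core_ineq`).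

* `sq_ne_one_of_isPrimitive_twoPower` — a primitive character mod `2^j`, `j ≥ 4`, is not quadratic (so the third
  function of the `3-4-1` is an entire `L(s, χ²)`, never `ζ`);
* `twoPowerZFR_of_LFunctionGrowth` — ★ `HG(C) → HZ` (any real `C`);
* `alignedTypeI_of_LFunctionGrowth` — ★★ `HG(C) → AlignedTypeI` BY NAME (composition with `alignedTypeI_of_twoPowerZFR`).

`HG` is what Vinogradov-type short character-sum bounds for `2`-power moduli (Postnikov's formula + the tree's PROVED
Korobov bilinear bound `VKZeta.norm_Usum_pow_le` / `VMVTBound 32`) deliver by partial summation; that discharge is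
the remaining work (see the session census).

HONEST FRAMING. CONDITIONAL RESULT (hypothesis by arrow, no `def`); the leaf `AlignedTypeI` is NOT closed
unconditionally here; nothing bears on `VP ≠ VNP` (NOT proved).
-/

set_option linter.dupNamespace false

noncomputable section

namespace Summit.ValiantsHypothesis.ValiantsHypothesis.Theorems.LiouvilleSarnak.AlignedTypeI.CharactersModTwoN

open Complex Filter Topology Metric Set Finset
open scoped LSeries.notation ArithmeticFunction.vonMangoldt
open Literature.NumberTheory.LFunctions

/-! ### Primitive characters mod `2^j`, `j ≥ 4`, are not quadratic -/

/-- The arithmetic of the last layer: `(2^{e+2} + 1)² ≡ 2^{e+3} + 1 (mod 2^{e+4})`. [folklore] -/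
theorem sq_succ_two_pow_mod (e : ℕ) :
    (2 ^ (e + 2) + 1) ^ 2 % 2 ^ (e + 4) = (2 ^ (e + 3) + 1) % 2 ^ (e + 4) := by
  have h2 : 2 ^ (e + 2) = 4 * 2 ^ e := by rw [pow_add]; ring
  have h3 : 2 ^ (e + 3) = 8 * 2 ^ e := by rw [pow_add]; ring
  have h4 : 2 ^ (e + 4) = 16 * 2 ^ e := by rw [pow_add]; ring
  rw [h2, h3, h4]
  have : (4 * 2 ^ e + 1) ^ 2 = (8 * 2 ^ e + 1) + (16 * 2 ^ e) * 2 ^ e := by ring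
  rw [this, Nat.add_mul_mod_self_left]

/-- **A primitive Dirichlet character to the modulus `2^j`, `j ≥ 4`, is not quadratic**: if `χ² = χ₀` then `χ` is
trivial on the kernel `{1, 1 + 2^{j-1}} = {1, (1 + 2^{j-2})²}` of `(ℤ/2^j)ˣ → (ℤ/2^{j-1})ˣ`, so `χ` factors through
`2^{j-1}` and its conductor is `< 2^j`.  (The quadratic primitive characters of `2`-power conductor have conductor `4`
or `8`.) [folklore] -/
theorem sq_ne_one_of_isPrimitive_twoPower {j : ℕ} (hj : 4 ≤ j) (χ : DirichletCharacter ℂ (2 ^ j))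
    (hχ : χ.IsPrimitive) : χ ^ 2 ≠ 1 := by
  haveI : NeZero (2 ^ j) := ⟨pow_ne_zero _ two_ne_zero⟩
  intro h2
  obtain ⟨e, rfl⟩ := Nat.exists_eq_add_of_le hj
  have hdvd : 2 ^ (e + 3) ∣ 2 ^ (4 + e) := pow_dvd_pow 2 (by omega)
  have hfac : χ.FactorsThrough (2 ^ (e + 3)) := by
    rw [DirichletCharacter.factorsThrough_iff_ker_unitsMap hdvd]
    intro u hu
    rw [MonoidHom.mem_ker, Units.ext_iff, ZMod.unitsMap_val, ← ZMod.natCast_val, Units.val_one] at hu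
    rw [MonoidHom.mem_ker, Units.ext_iff, MulChar.coe_toUnitHom, Units.val_one]
    set a : ℕ := (u : ZMod (2 ^ (4 + e))).val with ha
    have ha_lt : a < 2 ^ (4 + e) := ZMod.val_lt _
    set m : ℕ := 2 ^ (e + 3) with hm
    have hm1 : 1 < m := by rw [hm]; exact Nat.one_lt_two_pow (by omega)
    have hjm : 2 ^ (4 + e) = 2 * m := by
      rw [hm, show 4 + e = (e + 3) + 1 by omega, pow_succ]; ring
    have hu' : a % m = 1 := by
      have h1 : ((a : ℕ) : ZMod m) = ((1 : ℕ) : ZMod m) := by rw [Nat.cast_one]; exact hu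
      rw [ZMod.natCast_eq_natCast_iff'] at h1
      rwa [Nat.mod_eq_of_lt hm1] at h1
    have hua : (u : ZMod (2 ^ (4 + e))) = (a : ZMod (2 ^ (4 + e))) := (ZMod.natCast_zmod_val _).symm
    -- `a = 1` or `a = m + 1`
    have hcases : a = 1 ∨ a = m + 1 := by
      have h1 := Nat.div_add_mod a m
      have h2 : a / m < 2 := by
        rw [Nat.div_lt_iff_lt_mul (by omega)]; omega
      interval_cases (a / m) <;> omega
    rcases hcases with h | h
    · rw [hua, h, Nat.cast_one, map_one]
    · -- `u = (2^{e+2} + 1)²`, a square, on which `χ = (χ²)^{1/2}` is trivial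
      set x : ℕ := 2 ^ (e + 2) + 1 with hx
      have hxodd : Odd x := by
        rw [hx]
        exact Even.add_one ((Nat.even_pow' (by omega)).2 even_two)
      have hxu : IsUnit ((x : ℕ) : ZMod (2 ^ (4 + e))) := by
        rw [ZMod.isUnit_iff_coprime]
        exact Nat.Coprime.pow_right _ hxodd.coprime_two_right
      have hsq : ((x : ℕ) : ZMod (2 ^ (4 + e))) ^ 2 = (a : ZMod (2 ^ (4 + e))) := by
        rw [← Nat.cast_pow, ZMod.natCast_eq_natCast_iff', h, hm, show 4 + e = e + 4 by omega]
        exact sq_succ_two_pow_mod e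
      rw [hua, ← hsq, map_pow, ← MulChar.pow_apply' χ two_ne_zero, h2, MulChar.one_apply hxu]
  have hcd : χ.conductor ∣ 2 ^ (e + 3) :=
    DirichletCharacter.conductor_dvd_of_mem_conductorSet χ
      ((DirichletCharacter.mem_conductorSet_iff χ).mpr hfac)
  rw [DirichletCharacter.isPrimitive_def] at hχ
  rw [hχ] at hcd
  have h1 := Nat.le_of_dvd (by positivity) hcd
  have h2 : 2 ^ (e + 3) < 2 ^ (4 + e) := Nat.pow_lt_pow_right (by norm_num) (by omega)
  omega

/-! ### `log j / j → 0`, `log² j / j → 0` along the naturals -/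

/-- `(log j)^n / j → 0` as `j → ∞` through `ℕ`. [folklore] -/
theorem tendsto_log_pow_div_natCast (n : ℕ) :
    Tendsto (fun j : ℕ => Real.log j ^ n / (j : ℝ)) atTop (𝓝 0) := by
  have h := (Real.tendsto_pow_log_div_mul_add_atTop 1 0 n one_ne_zero).comp tendsto_natCast_atTop_atTop
  refine h.congr fun j => ?_
  simp [Function.comp]

/-! ### The zero-free region from the growth hypothesis -/

/-- ★ **`HZ` from polynomial growth of `L(s, χ mod 2^j)` within `K log²j/j` of `σ = 1` (Landau–Titchmarsh in the
depth aspect; CONDITIONAL by arrow).**  Suppose that for some real `C` and EVERY `K > 0`, eventually in `j`, every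
non-principal `χ (mod 2^j)` has `‖L(z, χ)‖ ≤ j^C` on `1 − K log²j/j ≤ Re z ≤ 2`, `|Im z| ≤ 2j³ + 1`.  Then for every
`A > 0`, eventually in `j`, the primitive `χ (mod 2^j)` have no zeros `ρ = β + iγ`, `0 < β < 1`, `|γ| ≤ j³`, with
`β > 1 − A log j/j`.  Proof: Titchmarsh's Lemma α (`VKFromRichert.neg_re_logDeriv_le`) on the discs of radius
`2R = K log²j/j` about `1 + d + iγ`, `1 + d + 2iγ` (`d = 8A log j/j`, `K = 2304 A (max C 1 + 3)`), the lower bound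
`‖L(1 + d + it, χ)‖ ≥ d/2`, `−ζ'/ζ(1 + d) ≤ 1/d + K₀`, and MV Lemma 11.2 (`3-4-1`) with third function `L(·, χ²)`
(`χ² ≠ χ₀` by `sq_ne_one_of_isPrimitive_twoPower`). [cite: Titchmarsh1986, Theorem 3.10 (proof)]
[cite: MontgomeryVaughan2007, Lemma 11.2] -/
theorem twoPowerZFR_of_LFunctionGrowth (C : ℝ)
    (hG : ∀ K : ℝ, 0 < K → ∃ j₀ : ℕ, ∀ j : ℕ, j₀ ≤ j → ∀ χ : DirichletCharacter ℂ (2 ^ j), χ ≠ 1 →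
      ∀ z : ℂ, 1 - K * Real.log j ^ 2 / j ≤ z.re → z.re ≤ 2 → |z.im| ≤ 2 * (j : ℝ) ^ 3 + 1 →
        ‖χ.LFunction z‖ ≤ (j : ℝ) ^ C) :
    ∀ A : ℝ, 0 < A → ∃ j₀ : ℕ, ∀ j : ℕ, j₀ ≤ j → ∀ χ : DirichletCharacter ℂ (2 ^ j), χ.IsPrimitive →
      ∀ ρ : ℂ, χ.LFunction ρ = 0 → 0 < ρ.re → ρ.re < 1 → |ρ.im| ≤ (j : ℝ) ^ 3 →
        ρ.re ≤ 1 - A * Real.log j / j := by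
  intro A hA
  obtain ⟨K₀, hK₀, hK, -⟩ := DirichletZFR.exists_norm_logDeriv_le
  -- normalised exponent and the constant `K` of the growth hypothesis
  set C' : ℝ := max C 1 with hC'def
  have hC'1 : 1 ≤ C' := le_max_right _ _
  have hCC' : C ≤ C' := le_max_left _ _
  set K : ℝ := 2304 * A * (C' + 3) with hKdef
  have hK0 : 0 < K := by positivity
  obtain ⟨j₁, hj₁⟩ := hG K hK0
  -- the eventual conditions on `j`
  have hT1 := tendsto_log_pow_div_natCast 1
  have hT2 := tendsto_log_pow_div_natCast 2
  simp only [pow_one] at hT1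
  have hE1 : ∀ᶠ j : ℕ in atTop, j₁ ≤ j := eventually_ge_atTop _
  have hE2 : ∀ᶠ j : ℕ in atTop, 4 ≤ j := eventually_ge_atTop _
  have hE3 : ∀ᶠ j : ℕ in atTop, Real.log j ^ 2 / (j : ℝ) < 1 / (8 * K) :=
    hT2.eventually (gt_mem_nhds (by positivity))
  have hE4 : ∀ᶠ j : ℕ in atTop, Real.log j / (j : ℝ) < 1 / (16 * A) :=
    hT1.eventually (gt_mem_nhds (by positivity))
  have hE5 : ∀ᶠ j : ℕ in atTop, Real.log j / (j : ℝ) < 5 / (432 * A * (K₀ + 1)) :=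
    hT1.eventually (gt_mem_nhds (by positivity))
  have hE6 : ∀ᶠ j : ℕ in atTop, ⌈1 / (4 * A)⌉₊ ≤ j := eventually_ge_atTop _
  obtain ⟨j₀, hj₀⟩ := Filter.eventually_atTop.1 (hE1.and (hE2.and (hE3.and (hE4.and (hE5.and hE6)))))
  refine ⟨j₀, fun j hj χ hχ ρ hρ hρ0 hρ1 hγ => ?_⟩
  obtain ⟨h1, h2, h3, h4, h5, h6⟩ := hj₀ j hj
  haveI : NeZero (2 ^ j) := ⟨pow_ne_zero _ two_ne_zero⟩
  have hχ1 : χ ≠ 1 := ne_one_of_isPrimitive_twoPower (by omega) χ hχ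
  have hχ2 : χ ^ 2 ≠ 1 := sq_ne_one_of_isPrimitive_twoPower h2 χ hχ
  -- real bookkeeping
  have hj4 : (4 : ℝ) ≤ j := by exact_mod_cast h2
  have hj0 : (0 : ℝ) < j := by linarith
  have hj1' : (1 : ℝ) ≤ j := by linarith
  set ℓ : ℝ := Real.log j with hℓdef
  have hℓ1 : 1 ≤ ℓ := by
    have hlog4 : 1 ≤ Real.log 4 := by
      rw [← Real.log_exp 1]
      exact Real.log_le_log (Real.exp_pos 1) (by have := Real.exp_one_lt_d9; linarith)
    exact hlog4.trans (Real.log_le_log (by norm_num) hj4)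
  have hℓ0 : 0 < ℓ := by linarith
  have h6' : 1 / (4 * A) ≤ (j : ℝ) := Nat.ceil_le.1 h6
  -- the parameters
  set d : ℝ := 8 * A * ℓ / j with hddef
  set R : ℝ := K * ℓ ^ 2 / (2 * j) with hRdef
  set M : ℝ := (j : ℝ) ^ C' with hMdef
  set E : ℝ := 8 * (Real.log (2 * M / d) + 1) / R with hEdef
  clear_value C' K ℓ d R M E
  have hd0 : 0 < d := by rw [hddef]; positivity
  have hR0 : 0 < R := by rw [hRdef]; positivity
  have hM0 : 0 < M := by rw [hMdef]; exact Real.rpow_pos_of_pos hj0 _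
  have hM1 : 1 ≤ M := by rw [hMdef]; exact Real.one_le_rpow hj1' (by linarith)
  have hd8 : d / 8 = A * ℓ / j := by rw [hddef]; ring
  -- `d < 1/2`
  have hd_half : d < 1 / 2 := by
    have e1 : d = 8 * A * (ℓ / j) := by rw [hddef]; ring
    rw [e1]
    calc 8 * A * (ℓ / j) < 8 * A * (1 / (16 * A)) := by gcongr
      _ = 1 / 2 := by rw [mul_one_div, div_eq_div_iff (by positivity) (by norm_num)]; ring
  have hd1 : d ≤ 1 := by linarith only [hd_half]
  -- `R < 1/16`
  have hR16' : R < 1 / 16 := by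
    have e1 : R = K / 2 * (ℓ ^ 2 / j) := by rw [hRdef]; ring
    rw [e1]
    calc K / 2 * (ℓ ^ 2 / j) < K / 2 * (1 / (8 * K)) := by gcongr
      _ = 1 / 16 := by rw [mul_one_div, div_div, div_eq_div_iff (by positivity) (by norm_num)]; ring
  have hR16 : R ≤ 1 / 16 := hR16'.le
  have h2R : 2 * R = K * ℓ ^ 2 / j := by rw [hRdef]; ring
  -- `9d/8 ≤ R` (`18 A ≤ K ℓ`)
  have h9d : 9 * d ≤ 8 * R := by
    rw [hddef, hRdef]
    rw [show 9 * (8 * A * ℓ / j) = (72 * A * ℓ) / j by ring,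
      show 8 * (K * ℓ ^ 2 / (2 * j)) = (4 * K * ℓ ^ 2) / j by field_simp; ring]
    refine div_le_div_of_nonneg_right ?_ hj0.le
    have hK18 : 18 * A ≤ K := by
      rw [hKdef]
      have h13 : (1 : ℝ) ≤ C' + 3 := by linarith only [hC'1]
      have := mul_le_mul_of_nonneg_left h13 hA.le
      linarith only [this, hA]
    have hℓsq : ℓ ≤ ℓ ^ 2 := by nlinarith only [hℓ1]
    have hA4 : 72 * A * ℓ ≤ 4 * K * ℓ := by nlinarith only [hK18, hℓ0]
    have hK4 : 4 * K * ℓ ≤ 4 * K * ℓ ^ 2 := by nlinarith only [hℓsq, hK0]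
    linarith only [hA4, hK4]
  have hdR : d ≤ R := by linarith only [h9d, hd0]
  -- the decisive estimate `3K₀ + 5E < 5/(9d)`
  have hℓne : ℓ ≠ 0 := hℓ0.ne'
  have hjne : (j : ℝ) ≠ 0 := hj0.ne'
  have hAne : A ≠ 0 := hA.ne'
  have hC3 : 0 < C' + 3 := by linarith
  have hlogMd : Real.log (2 * M / d) + 1 ≤ (C' + 3) * ℓ := by
    have e1 : 2 * M / d = M * (j / (4 * A * ℓ)) := by rw [hddef]; field_simp; ring
    have h4Aj : 1 ≤ 4 * A * j := by
      have := h6'; rw [div_le_iff₀ (by positivity)] at this; linarith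
    have hprod : (1 : ℝ) ≤ j * (4 * A * ℓ) :=
      calc (1 : ℝ) ≤ 4 * A * j := h4Aj
        _ ≤ 4 * A * j * ℓ := le_mul_of_one_le_right (by positivity) hℓ1
        _ = j * (4 * A * ℓ) := by ring
    have e2 : (j : ℝ) / (4 * A * ℓ) ≤ j * j := by
      rw [div_le_iff₀ (by positivity)]
      have h := mul_le_mul_of_nonneg_left hprod hj0.le
      calc (j : ℝ) = j * 1 := (mul_one _).symm
        _ ≤ j * (j * (4 * A * ℓ)) := h
        _ = j * j * (4 * A * ℓ) := by ring
    have hle : 2 * M / d ≤ M * (j * j) := by rw [e1]; exact mul_le_mul_of_nonneg_left e2 hM0.le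
    have hlog : Real.log (2 * M / d) ≤ Real.log (M * (j * j)) := Real.log_le_log (by positivity) hle
    have hlogM : Real.log M = C' * ℓ := by rw [hMdef, Real.log_rpow hj0, hℓdef]
    have hlog2 : Real.log (M * (j * j)) = C' * ℓ + ℓ + ℓ := by
      rw [Real.log_mul hM0.ne' (by positivity), Real.log_mul hjne hjne, hlogM, ← hℓdef]
      ring
    rw [hlog2] at hlog
    linarith only [hlog, hℓ1]
  have hE_le : E ≤ j / (144 * A * ℓ) := by
    have e1 : E ≤ 8 * ((C' + 3) * ℓ) / R := by
      rw [hEdef]; gcongr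
    have e2 : 8 * ((C' + 3) * ℓ) / R = j / (144 * A * ℓ) := by
      rw [hRdef, hKdef]; field_simp; ring
    linarith only [e1, e2]
  have hK₀_le : 3 * K₀ < 5 * j / (144 * A * ℓ) := by
    have h5' := (div_lt_div_iff₀ hj0 (by positivity)).1 h5
    rw [lt_div_iff₀ (by positivity)]
    have : 0 ≤ A * ℓ := by positivity
    have e : ℓ * (432 * A * (K₀ + 1)) = 3 * K₀ * (144 * A * ℓ) + 432 * (A * ℓ) := by ring
    linarith only [h5', this, e]
  have hdec : 3 * K₀ + 5 * E < 5 / (9 * d) := by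
    have e1 : 5 / (9 * d) = 5 * j / (144 * A * ℓ) + 5 * (j / (144 * A * ℓ)) := by
      rw [hddef]; field_simp; ring
    rw [e1]
    linarith only [hK₀_le, hE_le]
  -- the zero, by contradiction
  by_contra hlt
  rw [not_le] at hlt
  set η : ℝ := 1 - ρ.re with hηdef
  have hη0 : 0 < η := by rw [hηdef]; linarith only [hρ1]
  have hηd : η < d / 8 := by rw [hd8, hηdef]; linarith only [hlt]
  -- the centres
  have hσ : 1 < 1 + d := by linarith only [hd0]
  set γ : ℝ := ρ.im with hγdef
  set c₁ : ℂ := ((1 + d : ℝ) : ℂ) + (γ : ℂ) * I with hc₁def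
  set c₂ : ℂ := ((1 + d : ℝ) : ℂ) + ((2 * γ : ℝ) : ℂ) * I with hc₂def
  clear_value η γ c₁ c₂
  have hc₁re : c₁.re = 1 + d := by simp [hc₁def]
  have hc₁im : c₁.im = γ := by simp [hc₁def]
  have hc₂re : c₂.re = 1 + d := by simp [hc₂def]
  have hc₂im : c₂.im = 2 * γ := by simp [hc₂def]
  have hc₁1 : 1 < c₁.re := by rw [hc₁re]; exact hσ
  have hc₂1 : 1 < c₂.re := by rw [hc₂re]; exact hσ
  have e₁ : ((1 + d : ℝ) : ℂ) + (γ : ℂ) * I = c₁ := hc₁def.symm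
  have e₂ : ((1 + d : ℝ) : ℂ) + 2 * (γ : ℂ) * I = c₂ := by
    rw [hc₂def]; push_cast; ring
  -- the discs lie in the region of the growth hypothesis
  have hγj : |γ| ≤ (j : ℝ) ^ 3 := hγ
  have hdisc : ∀ c : ℂ, c.re = 1 + d → |c.im| ≤ 2 * (j : ℝ) ^ 3 →
      ∀ z ∈ closedBall c (2 * R),
        1 - K * Real.log j ^ 2 / j ≤ z.re ∧ z.re ≤ 2 ∧ |z.im| ≤ 2 * (j : ℝ) ^ 3 + 1 := by
    intro c hcre hcim z hz
    rw [mem_closedBall, dist_eq_norm] at hz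
    obtain ⟨hre1, hre2⟩ := abs_le.1 ((Complex.abs_re_le_norm (z - c)).trans hz)
    obtain ⟨him1, him2⟩ := abs_le.1 ((Complex.abs_im_le_norm (z - c)).trans hz)
    rw [Complex.sub_re, hcre] at hre1 hre2
    rw [Complex.sub_im] at him1 him2
    obtain ⟨hci1, hci2⟩ := abs_le.1 hcim
    rw [← hℓdef, ← h2R]
    refine ⟨by linarith only [hre1, hd0], by linarith only [hre2, hd_half, hR16], abs_le.2 ⟨?_, ?_⟩⟩
    · linarith only [him1, hci1, hR16]
    · linarith only [him2, hci2, hR16]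
  have hMof : ∀ (ψ : DirichletCharacter ℂ (2 ^ j)), ψ ≠ 1 → ∀ c : ℂ, c.re = 1 + d →
      |c.im| ≤ 2 * (j : ℝ) ^ 3 → ∀ z ∈ closedBall c (2 * R), ‖ψ.LFunction z‖ ≤ M := by
    intro ψ hψ c hcre hcim z hz
    obtain ⟨hz1, hz2, hz3⟩ := hdisc c hcre hcim z hz
    refine (hj₁ j h1 ψ hψ z hz1 hz2 hz3).trans ?_
    rw [hMdef]
    exact Real.rpow_le_rpow_of_exponent_le hj1' hCC'
  have hj3 : 0 ≤ (j : ℝ) ^ 3 := by positivity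
  have hc₁imb : |c₁.im| ≤ 2 * (j : ℝ) ^ 3 := by
    rw [hc₁im]
    linarith only [hγj, hj3]
  have hc₂imb : |c₂.im| ≤ 2 * (j : ℝ) ^ 3 := by
    rw [hc₂im, abs_mul, abs_two]; linarith only [hγj, hj3]
  -- lower bounds at the centres
  have hlow : ∀ {c : ℂ}, c.re = 1 + d → ∀ {x : ℝ}, (c.re - 1) / c.re ≤ x → d / 2 ≤ x := by
    intro c hc x hx
    rw [hc] at hx
    have : d / 2 ≤ (1 + d - 1) / (1 + d) := by
      rw [div_le_div_iff₀ (by norm_num) (by linarith only [hd0])]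
      have hdd : d * d ≤ d * 1 := mul_le_mul_of_nonneg_left hd1 hd0.le
      linarith only [hdd, hd0]
    exact this.trans hx
  have hE_eq : E = 8 * (Real.log (2 * M / d) + 1) / R := hEdef
  -- X₀
  have hX₀ : (L ↗Λ ((1 + d : ℝ) : ℂ)).re ≤ 1 / d + K₀ :=
    DirichletZFR.re_LSeries_vonMangoldt_le hK hd0 hd1
  -- X₁
  have hX₁ : (L (↗χ * ↗Λ) c₁).re ≤ E - 1 / (d + η) := by
    have hMdisc := hMof χ hχ1 c₁ hc₁re hc₁imb
    have hdiff : DifferentiableOn ℂ χ.LFunction (ball c₁ (1 / 4)) :=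
      (DirichletCharacter.differentiable_LFunction hχ1).differentiableOn
    have hzeros : ∀ a, χ.LFunction a = 0 → ‖a - c₁‖ ≤ R → a.re < c₁.re := by
      intro a ha _
      rw [hc₁re]
      have : a.re < 1 := by
        by_contra hcon
        exact DirichletCharacter.LFunction_ne_zero_of_one_le_re χ (Or.inl hχ1) (not_lt.1 hcon) ha
      linarith only [this, hd0]
    have hfc : d / 2 ≤ ‖χ.LFunction c₁‖ := hlow hc₁re (DirichletZFR.norm_LFunction_ge χ hc₁1)
    obtain ⟨-, hα⟩ := VKFromRichert.neg_re_logDeriv_le (M := M) hdiff hR0 hR16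
      (fun z hz ↦ hMdisc z hz) hd0 hfc hzeros
    have hρc : ‖ρ - c₁‖ ≤ R := by
      have e : ρ - c₁ = ((ρ.re - (1 + d) : ℝ) : ℂ) :=
        Complex.ext (by simp [hc₁def]) (by simp [hc₁def, hγdef])
      rw [e, Complex.norm_real, Real.norm_eq_abs, abs_le]
      constructor
      · linarith only [hlt, hd8, h9d, hd0]
      · linarith only [hρ1, hd0, hR0]
    have h := hα ρ hρ hρc (by rw [hc₁im, hγdef])
    rw [hc₁re, ← hE_eq] at h
    rw [← DirichletZFR.neg_logDeriv_LFunction_eq χ hc₁1]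
    have e3 : 1 + d - ρ.re = d + η := by rw [hηdef]; ring
    rw [e3] at h
    exact h
  -- X₂ (third function `L(·, χ²)`, `χ² ≠ χ₀`)
  have hX₂ : (L (↗(χ ^ 2) * ↗Λ) c₂).re ≤ E := by
    have hMdisc := hMof (χ ^ 2) hχ2 c₂ hc₂re hc₂imb
    have hdiff : DifferentiableOn ℂ (χ ^ 2).LFunction (ball c₂ (1 / 4)) :=
      (DirichletCharacter.differentiable_LFunction hχ2).differentiableOn
    have hzeros : ∀ a, (χ ^ 2).LFunction a = 0 → ‖a - c₂‖ ≤ R → a.re < c₂.re := by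
      intro a ha _
      rw [hc₂re]
      have : a.re < 1 := by
        by_contra hcon
        exact DirichletCharacter.LFunction_ne_zero_of_one_le_re (χ ^ 2) (Or.inl hχ2) (not_lt.1 hcon) ha
      linarith only [this, hd0]
    have hfc : d / 2 ≤ ‖(χ ^ 2).LFunction c₂‖ :=
      hlow hc₂re (DirichletZFR.norm_LFunction_ge (χ ^ 2) hc₂1)
    obtain ⟨hα, -⟩ := VKFromRichert.neg_re_logDeriv_le (M := M) hdiff hR0 hR16
      (fun z hz ↦ hMdisc z hz) hd0 hfc hzeros
    rw [← hE_eq] at hα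
    rw [← DirichletZFR.neg_logDeriv_LFunction_eq (χ ^ 2) hc₂1]
    exact hα
  -- 3-4-1 and the contradiction
  have h341 := DirichletZFR.three_four_one χ hσ γ
  rw [e₂, e₁] at h341
  have hfin := VKFromRichert.three_four_one_algebra h341 hX₀ hX₁ hX₂
  have hcore := VKFromRichert.core_ineq hd0 hη0 hfin hηd
  exact absurd (hdec.trans hcore) (lt_irrefl _)

/-- ★★ **`AlignedTypeI` from polynomial growth of `L(s, χ mod 2^j)` within `K log²j/j` of `σ = 1`** (CONDITIONAL by
arrow on `HG(C)`, the hypothesis of `twoPowerZFR_of_LFunctionGrowth`): composition with `alignedTypeI_of_twoPowerZFR`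
(`…BilinearSieveZeroFreeFinal.lean`).  `HG` is a depth-aspect Richert/Vinogradov-type bound (Postnikov 1956, Gallagher
1972, Iwaniec 1974 give `‖L(σ + it, χ)‖ ≪ (log q)^{O(1)}` much deeper, for `σ ≥ 1 − c (log q)^{-2/3}(log log q)^{-1/3}`);
its discharge from the tree's proved Vinogradov mean value theorem is the remaining work. [folklore] -/
theorem alignedTypeI_of_LFunctionGrowth (C : ℝ)
    (hG : ∀ K : ℝ, 0 < K → ∃ j₀ : ℕ, ∀ j : ℕ, j₀ ≤ j → ∀ χ : DirichletCharacter ℂ (2 ^ j), χ ≠ 1 →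
      ∀ z : ℂ, 1 - K * Real.log j ^ 2 / j ≤ z.re → z.re ≤ 2 → |z.im| ≤ 2 * (j : ℝ) ^ 3 + 1 →
        ‖χ.LFunction z‖ ≤ (j : ℝ) ^ C) :
    Summit.ValiantsHypothesis.ValiantsHypothesis.Theses.LiouvilleSarnak.AlignedTypeI :=
  alignedTypeI_of_twoPowerZFR (twoPowerZFR_of_LFunctionGrowth C hG)

end Summit.ValiantsHypothesis.ValiantsHypothesis.Theorems.LiouvilleSarnak.AlignedTypeI.CharactersModTwoN
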